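import Summits.Parity.GeneralizedHardyLittlewood.Theorems.GreenTaoLevelTwoMNTwoVerticalSmoothing
import Summits.Parity.GeneralizedHardyLittlewood.Theorems.GreenTaoLevelTwoMNTwoVerticalMultiplier
import HarnessLib

/-!
# Route `GreenTaoLevelTwo`, crux `MNTwo` (stmt-Parity-21276), line `birth`: double smoothing and
# Fourier truncation (the harmonic-analysis core of `stub_verticalReduction`, IV)

Continuing `…MNTwoVerticalSmoothing` / `…MNTwoVerticalMultiplier`: along a central frame `ι` of
`Y = (G/Γ, d)`,

* the box smoothing `S_s F` of a `1`-bounded `M`-Lipschitz `F` is `1`-bounded and `L M`-Lipschitz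
  (`isBoundedLipschitz_smooth`), so it can be smoothed again; the vertical Fourier components of
  the DOUBLE smoothing `S_s S_s F` are bounded by the squared multiplier weights
  `|(S_s S_s F)_n(x)| ≤ (∏ᵢ bᵢ(n))²`, `bᵢ(n) = 1` (`nᵢ = 0`), `min(1, (π s |nᵢ|)⁻¹)` (`nᵢ ≠ 0`)
  (`norm_vComp_smooth_smooth_le`) — a summable family with polynomial tails;
* TRUNCATION: for a continuous function `f` on `(ℝ/ℤ)^I` whose Fourier coefficients are dominated
  by a summable `W`, the value `f(0)` is within `∑_{n ∉ B} W(n)` of the finite Fourier sum over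
  any finite set `B` of frequencies (`norm_apply_zero_sub_sum_le`, Mathlib's
  `hasSum_mFourier_series_apply_of_summable`); the torus function of `G` along the frame takes
  the value `G(x)` at `0` (`torusFun_zero`).

With `…Bookkeeping`, `…CentralFrames`, `…VerticalComponents` this leaves, for the by-name close
of `stub_verticalReduction`, only the numerical tail estimate for the product weights and the
choice of `s`, `K` polynomial in `M/ε`.

References: B. Green, T. Tao, *The Möbius function is strongly orthogonal to nilsequences*,
Ann. of Math. 175 (2012), Lemma 3.7 and App. A [GreenTao2012Mobius].
-/

noncomputable section

open MeasureTheory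
open Literature.NumberTheory.Sieve
open Summit.Parity.GeneralizedHardyLittlewood.GreenTaoLevelTwoMNTwoVerticalComponents
open Summit.Parity.GeneralizedHardyLittlewood.GreenTaoLevelTwoMNTwoVerticalSmoothing
open Summit.Parity.GeneralizedHardyLittlewood.GreenTaoLevelTwoMNTwoVerticalMultiplier

namespace Summit.Parity.GeneralizedHardyLittlewood.GreenTaoLevelTwoMNTwoVerticalTruncation

variable {s : ℕ} (Y : Nilmanifold s) {I : Type} (ι : (I → ℝ) → Y.G)

/-! ### §1 The smoothing as a bounded Lipschitz function; double smoothing -/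

/-- **`S_s F` is `1`-bounded and `L M`-Lipschitz** (packaged as `IsBoundedLipschitz`).
[cite: GreenTao2012Mobius, Lemma 3.7] -/
theorem isBoundedLipschitz_smooth [Fintype I] (hcont : Continuous ι) {L M : ℝ} (hM : 0 ≤ M)
    (hlip : ∀ (t : I → ℝ) (p q : Y.G ⧸ Y.Γ), Y.dist (ι t • p) (ι t • q) ≤ L * Y.dist p q)
    {F : Y.G ⧸ Y.Γ → ℝ} (hF : Y.IsBoundedLipschitz M F) (r : ℝ) :
    Y.IsBoundedLipschitz (L * M) fun y =>
      ∫ σ : UnitAddTorus I, F (ι (fun i => r * (AddCircle.equivIco (1 : ℝ) 0 (σ i) : ℝ)) • y)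
        ∂(Measure.pi fun _ : I => AddCircle.haarAddCircle) :=
  ⟨fun y => abs_smooth_le_one Y ι hF.1 r y,
    fun y z => abs_smooth_sub_smooth_le Y ι hcont hM hlip hF r y z⟩

/-- **Squared multiplier bound for the double smoothing**:
`|(S_s S_s F)_n(x)| ≤ (∏ᵢ bᵢ(n))²`. [cite: GreenTao2012Mobius, Lemma 3.7 and App. A] -/
theorem norm_vComp_smooth_smooth_le [Fintype I] (hadd : ∀ t u, ι (t + u) = ι t * ι u)
    (hcen : ∀ t, ι t ∈ Subgroup.center Y.G) (hΓ : ∀ n : I → ℤ, ι (fun i => (n i : ℝ)) ∈ Y.Γ)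
    (hcont : Continuous ι) {L M : ℝ} (hM : 0 ≤ M)
    (hlip : ∀ (t : I → ℝ) (p q : Y.G ⧸ Y.Γ), Y.dist (ι t • p) (ι t • q) ≤ L * Y.dist p q)
    {F : Y.G ⧸ Y.Γ → ℝ} (hF : Y.IsBoundedLipschitz M F) {r : ℝ} (hr : r ≠ 0) (x : Y.G ⧸ Y.Γ)
    (n : I → ℤ) :
    ‖UnitAddTorus.mFourierCoeff
        (fun τ : UnitAddTorus I =>
          ((∫ σ : UnitAddTorus I,
              (fun y => ∫ σ' : UnitAddTorus I,
                  F (ι (fun i => r * (AddCircle.equivIco (1 : ℝ) 0 (σ' i) : ℝ)) • y)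
                  ∂(Measure.pi fun _ : I => AddCircle.haarAddCircle))
                (ι (fun i => r * (AddCircle.equivIco (1 : ℝ) 0 (σ i) : ℝ)) •
                  (ι (fun i => (AddCircle.equivIco (1 : ℝ) 0 (τ i) : ℝ)) • x))
              ∂(Measure.pi fun _ : I => AddCircle.haarAddCircle) : ℝ) : ℂ)) n‖ ≤
      (∏ i, (if n i = 0 then (1 : ℝ) else min 1 (1 / (Real.pi * |r| * |(n i : ℝ)|)))) ^ 2 := by
  have hSF := isBoundedLipschitz_smooth Y ι hcont hM hlip hF r
  -- first smoothing layer (applied to `S_r F`)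
  rw [vComp_smooth Y ι hadd hcen hΓ hcont hSF x n r]
  -- second layer (applied to `F`)
  have h2 := vComp_smooth Y ι hadd hcen hΓ hcont hF x n r
  simp only at h2
  rw [h2, ← mul_assoc, norm_mul, norm_mul, sq]
  have hφ := norm_smoothMultiplier_le_prod n hr (I := I)
  have hc := norm_vComp_le_one Y ι hF.1 x n
  have hφ0 : 0 ≤ ‖∫ σ : UnitAddTorus I, UnitAddTorus.mFourier n
      (fun i => (((r * (AddCircle.equivIco (1 : ℝ) 0 (σ i) : ℝ) : ℝ)) : UnitAddCircle))
      ∂(Measure.pi fun _ : I => AddCircle.haarAddCircle)‖ := norm_nonneg _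
  have hb0 : 0 ≤ ∏ i, (if n i = 0 then (1 : ℝ) else min 1 (1 / (Real.pi * |r| * |(n i : ℝ)|))) :=
    Finset.prod_nonneg fun i _ => by split_ifs <;> [exact zero_le_one; exact le_min zero_le_one (by positivity)]
  calc _ ≤ (∏ i, (if n i = 0 then (1 : ℝ) else min 1 (1 / (Real.pi * |r| * |(n i : ℝ)|)))) *
        (∏ i, (if n i = 0 then (1 : ℝ) else min 1 (1 / (Real.pi * |r| * |(n i : ℝ)|)))) * 1 :=
        mul_le_mul (mul_le_mul hφ hφ hφ0 hb0) hc (norm_nonneg _) (mul_nonneg hb0 hb0)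
    _ = _ := by ring

/-! ### §2 Truncation of the Fourier series at the origin -/

/-- `e_n(0) = 1`. [folklore] -/
theorem mFourier_apply_zero [Fintype I] (n : I → ℤ) : UnitAddTorus.mFourier n (0 : UnitAddTorus I) = 1 := by
  simp only [UnitAddTorus.mFourier, ContinuousMap.coe_mk, Pi.zero_apply, fourier_eval_zero,
    Finset.prod_const_one]

/-- **Truncation**: if the Fourier coefficients of a continuous `f` on `(ℝ/ℤ)^I` are dominated by
a summable `W`, then `f(0)` is within `∑_{n ∉ B} W(n)` of the finite Fourier sum over any finite
set `B` of frequencies. [folklore] -/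
theorem norm_apply_zero_sub_sum_le [Fintype I] (f : C(UnitAddTorus I, ℂ)) {W : (I → ℤ) → ℝ}
    (hW : Summable W) (hdom : ∀ n, ‖UnitAddTorus.mFourierCoeff f n‖ ≤ W n) (B : Finset (I → ℤ)) :
    ‖f 0 - ∑ n ∈ B, UnitAddTorus.mFourierCoeff f n‖ ≤ ∑' n : ↑((B : Set (I → ℤ))ᶜ), W n := by
  have hsum : Summable (UnitAddTorus.mFourierCoeff f) := Summable.of_norm_bounded hW hdom
  have hhas := UnitAddTorus.hasSum_mFourier_series_apply_of_summable hsum (0 : UnitAddTorus I)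
  simp only [mFourier_apply_zero, smul_eq_mul, mul_one] at hhas
  rw [← hhas.tsum_eq, ← hsum.sum_add_tsum_compl (s := B), add_sub_cancel_left]
  have hWc : Summable fun n : ↑((B : Set (I → ℤ))ᶜ) => W n := hW.subtype _
  have hnc : Summable fun n : ↑((B : Set (I → ℤ))ᶜ) => ‖UnitAddTorus.mFourierCoeff f n‖ :=
    Summable.of_nonneg_of_le (fun _ => norm_nonneg _) (fun n => hdom n) hWc
  exact (norm_tsum_le_tsum_norm hnc).trans (hnc.tsum_le_tsum (fun n => hdom n) hWc)

/-- The lift of `0 ∈ (ℝ/ℤ)^I` is the zero vector. [folklore] -/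
theorem lift_zero [Fintype I] :
    (fun i => (AddCircle.equivIco (1 : ℝ) 0 ((0 : UnitAddTorus I) i) : ℝ)) = 0 := by
  funext i
  rw [Pi.zero_apply, Pi.zero_apply]
  have h0 : ((0 : ℝ) : UnitAddCircle) = 0 := rfl
  rw [← h0, AddCircle.equivIco_coe_of_mem]
  simp

/-- A frame homomorphism sends `0` to `1`. [folklore] -/
theorem frame_zero (hadd : ∀ t u, ι (t + u) = ι t * ι u) : ι 0 = 1 := by
  have h := hadd 0 0
  rw [add_zero] at h
  have h2 : ι 0 * ι 0 = ι 0 * 1 := by rw [mul_one]; exact h.symm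
  exact mul_left_cancel h2

/-- **The torus function of `G` along the frame takes the value `G(x)` at `0`.** [folklore] -/
theorem torusFun_zero [Fintype I] (hadd : ∀ t u, ι (t + u) = ι t * ι u) (G : Y.G ⧸ Y.Γ → ℝ)
    (x : Y.G ⧸ Y.Γ) :
    G (ι (fun i => (AddCircle.equivIco (1 : ℝ) 0 ((0 : UnitAddTorus I) i) : ℝ)) • x) = G x := by
  rw [lift_zero, frame_zero Y ι hadd, one_smul]

end Summit.Parity.GeneralizedHardyLittlewood.GreenTaoLevelTwoMNTwoVerticalTruncation
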